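import Mathlib
import Summits.NavierStokesRegularity.NavierStokesRegularity.Theses.UnthreadedRigidityDoor
import Summits.NavierStokesRegularity.NavierStokesRegularity.Theorems.SymmetryModuliCountAxisymEndLiouville
import HarnessLib

/-!
# `UnthreadedRigidityDoor.AxisymEndLiouville` (item stmt-NavierStokesRegularity-27586) — by name

The support item is SHARED VERBATIM with route SymmetryModuliCount's crux `AxisymEndLiouville`
(stmt-NavierStokesRegularity-14061), PROVED in the tree by
`Summit.NavierStokesRegularity.NavierStokesRegularity.Theorems.AxisymEndLiouville_of`
(`Theorems/SymmetryModuliCountAxisymEndLiouville.lean`, line absorbing-axis-swirl-extinction): a Type-I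
ancient mild profile that is infinitesimally axisymmetric (skew `A ≠ 0`, any centre `c`) on a backward
end `(−∞, θ)`, `θ ≤ 0`, vanishes there.  The two route decls are token-identical, so this file is the
one-line citation (director-ns dss_83 (i)).

HONEST FRAMING: nothing new is proved here; `UnthreadedRigidity` (stmt-27585), the door's Target and
Navier–Stokes regularity are OPEN; no summit statement is proved here.
-/

noncomputable section

set_option linter.dupNamespace false

namespace Summit.NavierStokesRegularity.NavierStokesRegularity.Theorems

/-- **Item stmt-NavierStokesRegularity-27586** (`UnthreadedRigidityDoor.AxisymEndLiouville`) — verbatim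
the PROVED crux 14061 of route SymmetryModuliCount, cited by name (`AxisymEndLiouville_of`).
[cite: KochNadirashviliSereginSverak2009, Thm 5.2 (arXiv:0709.3599)] -/
theorem unthreadedRigidityDoor_axisymEndLiouville_proof :
    Summit.NavierStokesRegularity.NavierStokesRegularity.Theses.UnthreadedRigidityDoor.AxisymEndLiouville :=
  AxisymEndLiouville_of

end Summit.NavierStokesRegularity.NavierStokesRegularity.Theorems

end
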